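/-
Copyright (c) 2026 the pub-hodgecm-mathlib formalisation cell (harness21).  Prover seat hodgecm-mathlib-K2E1-p08 (g5), Track B ∕ K2-LIT, h413 =
`stmt-HodgeConjecture-24833`, campaign «EIS-RANK-ONE» (q5) [D5]₃ SPHERICAL, Fréchet road, file (a2)₃: the EXPLICIT HEIGHT along the big-cell Heisenberg line of `U(2,1)`
(dealer K2E1-plan (g4) 2026-09-04T06:47:48Z PRIORITY FLIP; REPORT-FIRST 06:58Z).
-/
import Summits.HodgeConjecture.HodgeConjecture.Theorems.K2E1IntertwiningGrowthU3             -- ★ `lastRow_weylLongU_mul` (`e₃·w₀·y = e₁·y`), currency `borelHeight`, `weylLongU`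
import Summits.HodgeConjecture.HodgeConjecture.Theorems.K2E1HeightBigCellLineFormulaU2      -- ★ (a2)₂ (this seat): `norm_fst_algebraMap_adele`, `norm_ringEquiv_mixedSpace_symm_apply`, `isReal_comap_maximalRealSubfield`
import Literature.NumberTheory.Automorphic.UnitaryGroupHeisenbergFundamentalDomain          -- ★ `heisChart`, `coe_heisChart`, `mat_heisElt`, `heisMatrix`, `heisZ`
import Literature.NumberTheory.Automorphic.UnitaryGroupCuspIntegralSiegelMajorant           -- ★ `borelHeight_mul_of_mem_comap_standardMaximalCompactGL`
import Literature.NumberTheory.Automorphic.GaloisActionAdeleRing                            -- ★ `galInfiniteCompletionMap_coe`, `InfiniteAdeleRing.smul_apply`, `InfinitePlace.Completion.ext_of_coe`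
import Literature.NumberTheory.Automorphic.AdeleGaloisDescent                               -- ★ `norm_infiniteCompletionOfComap`, `infiniteCompletionOfComap_coe`
import HarnessLib

/-!
# K2·E1 — `K2E1HeightBigCellLineFormulaU3` ((q5) [D5]₃ file (a2)₃): THE HEIGHT ALONG THE BIG-CELL HEISENBERG LINE OF `U(2,1)` IS EXPLICIT —
# `H(ι(w₀)·u(X, θt)·k) = h(1, X, z(X, θt))⁻¹`, `z(X, y) = y − ½X·cX`, and over a CM field `1 + |X|_w² + |z|_w² = (1 + ½|X|_w²)² + (wδ)²·t_{w|L⁺}²`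

Track B ∕ K2-LIT, crux h413 = `stmt-HodgeConjecture-24833`, route of record `HCCMUnconditional`; cell `hodgecm-mathlib`, squad K2, ENGINE E1, campaign EIS-RANK-ONE, queue item (q5)
[D5]₃ SPHERICAL (the archimedean binders of ★ p857895 `K2E1FlatSectionLineRestrictionArchU3` for the spherical flat section of `U(J₃)`).  Prover seat `hodgecm-mathlib-K2E1-p08` (g5).
THEOREMS ONLY (no `def`, no `instance`, no notation, no named-fact hypothesis, no `sorry`); lane `--kind proof --supports stmt-HodgeConjecture-24833 --as helper` (count-neutral).

WHAT.  The `N = 3` twin of ★ (a2)₂ `K2E1HeightBigCellLineFormulaU2`.  Letters: `G = U(J₃)` (`quasiSplit F E c 3`), `u = heisChart hc : 𝔸_E × 𝔸_E⁻ ≃ₜ N(𝔸_F)` with matrix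
`π(u(X, y)) = [[1, X, z], [0, 1, −cX], [0, 0, 1]]`, `z = heisZ X y = y − ½·X·cX` (★ `mat_heisElt`), `θ = traceZeroLine F E c hcδ hδ : 𝔸_F ≃ 𝔸_E⁻` (`θ t = t ⊗ δ`), `ι_K = ringEquiv_mixedSpace K`.
* §1 (generic quadratic pair) `lastRow_weylLongU_mul_heisChart` : the last row of `ι(w₀)·u(X, y)` is `(1, X, z(X, y))` (★ `lastRow_weylLongU_mul`); hence
  **`borelHeight_weylLongU_mul_heisChart_mul`** : `H(ι(w₀)·u(X, y)·k) = h(1, X, z(X, y))⁻¹` for `k ∈ K_U`.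
* §2 (any number field) `vecHeight_one_three_adele_eq(_of_isTotallyComplex)` : `h(1, X, Z) = ∏_w √(1 + |X_w|² + |Z_w|²)^{mult w} · ∏ᶠ_v max(1, |X_v|_v, |Z_v|_v)`, `= ∏_w (1 + |X_w|² + |Z_w|²)·(…)`
  over a totally complex field.
* §3 THE CM ARCHIMEDEAN STRUCTURE (`L` CM, `c` = complex conjugation, `w ∣ ∞`, `ψ_w = extensionEmbedding w : L_w →+* ℂ` Mathlib's isometric embedding): `c • w = w`;
  `ψ_w((cX)_w) = conj ψ_w(X_w)` (`extensionEmbedding_fst_conjAdele`); `ψ_w((t ⊗ 1)_w) = (ι_{L⁺} t)_{w|L⁺} ∈ ℝ` (`extensionEmbedding_fst_baseChange`); `conj φ_w(δ) = −φ_w(δ)`; hence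
  `ψ_w(z(X, θ(ι⁻¹ s, b))_w) = s_{w|L⁺}·φ_w(δ) − ½‖X_w‖²` and the ORTHOGONALITY **`norm_sq_fst_heisZ_line`** : `‖z(X, θ(ι⁻¹ s, b))_w‖² = (wδ)²·s_{w|L⁺}² + ¼‖X_w‖⁴`.
* §4 the assembled formula **`coe_borelHeight_weylLongU_heisChart_line_mul_eq_cm_three`** : for `k ∈ K_U`, `X ∈ 𝔸_L`, `b ∈ 𝔸_{L⁺}^∞`, `s ∈ L⁺ ⊗ ℝ`,
  `H(ι(w₀)·u(X, θ(ι⁻¹ s, b))·k) = ((∏_{w∣∞} ((1 + ½‖X_w‖²)² + (wδ)²·s_{w|L⁺}²)) · h_f(X, b))⁻¹`, `h_f(X, b) = ∏ᶠ_v max(1, |X_v|, |z(X, θ(0,b))_v|) ≥ 1` — per place a positive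
  quadratic `A_w + c_w s²` in the centre variable (`A_w = (1 + ½‖X_w‖²)² ≥ 1`, `c_w = (wδ)² > 0`), the input of the symbol machinery ★ (a1) `K2E1OnePlusSqPowerSymbol` ∕ ★ (a3 core)
  `K2E1TensorSymbolProduct` for the centre layer (F) of ★ p857895.
[MoeglinWaldspurger1995, I.2.2, II.1.5; Garrett2018, §2.2; Rogawski1990, §1.10 (the Heisenberg chart).]

HONEST LABEL: HC_CM is proved only modulo the 7 printed citations (2 remaining named inputs: hLiu418 = `stmt-HodgeConjecture-24832`, h413 = `stmt-HodgeConjecture-24833`) until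
rung 0 closes; count-neutral helper, closes no socket.

## References
* [MoeglinWaldspurger1995] C. Mœglin, J.-L. Waldspurger, *Spectral Decomposition and Eisenstein Series* (1995), I.2.2, II.1.5.
* [Garrett2018] P. Garrett, *Modern Analysis of Automorphic Forms by Example* (2018), §2.2.
* [Rogawski1990] J. D. Rogawski, *Automorphic Representations of Unitary Groups in Three Variables* (1990), §1.10.
* [CasselsFrohlichANT1967] J. W. S. Cassels, A. Fröhlich (eds.), *Algebraic Number Theory* (1967), Ch. II §14, Ch. VII §1.1.
-/

set_option autoImplicit false
-- the mandated namespace repeats the single-problem summit's segment (`HodgeConjecture.HodgeConjecture`)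
set_option linter.dupNamespace false

noncomputable section

open NumberField NumberField.InfinitePlace NumberField.mixedEmbedding IsDedekindDomain Matrix
open Literature.NumberTheory.Automorphic Literature.NumberTheory.Automorphic.UnitaryGroup AdelicGroupData
open Summit.HodgeConjecture.HodgeConjecture.Cruxes.H413.K2E1IntertwiningGrowthU3 (lastRow_weylLongU_mul)
open Summit.HodgeConjecture.HodgeConjecture.Cruxes.H413.K2E1HeightBigCellLineFormulaU2 (norm_fst_algebraMap_adele norm_ringEquiv_mixedSpace_symm_apply)
-- `Classical` is needed to see the Mathlib normed-space instances on `mixedSpace` (note H5 of `AdelicGLnGlue`)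
open scoped NNReal MatrixGroups Classical ComplexConjugate

namespace Summit.HodgeConjecture.HodgeConjecture.Cruxes.H413.K2E1HeightBigCellLineFormulaU3

/-! ## §1 The last row of `ι(J₃)·u(X, y)` and the height `H(ι(w₀)·u(X, y)·k) = h(1, X, z(X, y))⁻¹` -/

section BigCell

variable {F E : Type} [Field F] [NumberField F] [Field E] [NumberField E] [Algebra F E] {c : E ≃ₐ[F] E}

/-- **THE LAST ROW OF `ι(J₃)·u(X, y)` IS `(1, X, z(X, y))`**: `e₃·J₃·π(u) = e₁·π(u)` is the first row of the Heisenberg matrix (★ `lastRow_weylLongU_mul`, ★ `mat_heisElt`).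
[cite: MoeglinWaldspurger1995, I.2.2] [cite: Rogawski1990, §1.10] -/
theorem lastRow_weylLongU_mul_heisChart (hc : c * c = 1) (X : AdeleRing (𝓞 E) E) (y : traceZeroAdele F E c) :
    lastRow ((quasiSplit F E c 3).toAdelic (weylLongU (c : E →+* E) (rfl : (StdForm.antidiagonal 3).over E = (StdForm.antidiagonal 3).over E)) *
      ((heisChart hc (X, y) : adelicUnipotent F E c 3) : (quasiSplit F E c 3).Adelic)) =
      ![1, X, heisZ (c := c) X y] := by
  rw [lastRow_weylLongU_mul, coe_heisChart, mat_heisElt]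
  funext j
  fin_cases j <;> simp [heisMatrix]

/-- **`H(ι(w₀)·u(X, y)) = h(1, X, z(X, y))⁻¹`** on `U(J₃)(𝔸_F)`. [cite: MoeglinWaldspurger1995, I.2.2] [cite: Garrett2018, §2.2] -/
theorem borelHeight_weylLongU_mul_heisChart (hc : c * c = 1) (X : AdeleRing (𝓞 E) E) (y : traceZeroAdele F E c) :
    borelHeight ((quasiSplit F E c 3).toAdelic (weylLongU (c : E →+* E) (rfl : (StdForm.antidiagonal 3).over E = (StdForm.antidiagonal 3).over E)) *
      ((heisChart hc (X, y) : adelicUnipotent F E c 3) : (quasiSplit F E c 3).Adelic)) =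
      (vecHeight E (![1, X, heisZ (c := c) X y] : Fin 3 → AdeleRing (𝓞 E) E))⁻¹ := by
  rw [borelHeight_def, lastRow_weylLongU_mul_heisChart]

/-- **`H(ι(w₀)·u(X, y)·k) = h(1, X, z(X, y))⁻¹` FOR `k ∈ K_U`** (★ `borelHeight_mul_of_mem_comap_standardMaximalCompactGL`). [cite: MoeglinWaldspurger1995, I.2.2] [cite: Garrett2018, §2.2] -/
theorem borelHeight_weylLongU_mul_heisChart_mul (hc : c * c = 1) (X : AdeleRing (𝓞 E) E) (y : traceZeroAdele F E c) {k : (quasiSplit F E c 3).Adelic}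
    (hk : k ∈ ((standardMaximalCompactGL 3 E).comap (adelicVal F E c 3 ((StdForm.antidiagonal 3).over E)) : Subgroup (quasiSplit F E c 3).Adelic)) :
    borelHeight ((quasiSplit F E c 3).toAdelic (weylLongU (c : E →+* E) (rfl : (StdForm.antidiagonal 3).over E = (StdForm.antidiagonal 3).over E)) *
      ((heisChart hc (X, y) : adelicUnipotent F E c 3) : (quasiSplit F E c 3).Adelic) * k) =
      (vecHeight E (![1, X, heisZ (c := c) X y] : Fin 3 → AdeleRing (𝓞 E) E))⁻¹ := by
  rw [borelHeight_mul_of_mem_comap_standardMaximalCompactGL hk, borelHeight_weylLongU_mul_heisChart]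

end BigCell

/-! ## §2 The height of `(1, X, Z)` in closed form -/

section AffineLine

variable (K : Type) [Field K] [NumberField K]

/-- `h_v(1, X, Z) = max(1, |X_v|_v, |Z_v|_v)` at a finite place. [cite: Garrett2018, §2.2] -/
theorem vecFinHeight_one_three_adele (X Z : AdeleRing (𝓞 K) K) (v : HeightOneSpectrum (𝓞 K)) :
    vecFinHeight K v (![1, X, Z] : Fin 3 → AdeleRing (𝓞 K) K) = max 1 (max ‖X.2 v‖₊ ‖Z.2 v‖₊) := by
  refine le_antisymm (vecFinHeight_le fun i => ?_) (max_le ?_ (max_le ?_ ?_))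
  · fin_cases i
    · change ‖((1 : AdeleRing (𝓞 K) K)).2 v‖₊ ≤ _
      rw [show ((1 : AdeleRing (𝓞 K) K)).2 v = 1 from rfl, nnnorm_one]
      exact le_max_left _ _
    · exact (le_max_left _ _).trans (le_max_right _ _)
    · exact (le_max_right _ _).trans (le_max_right _ _)
  · have h := nnnorm_snd_apply_le_vecFinHeight v (![1, X, Z] : Fin 3 → AdeleRing (𝓞 K) K) 0
    have h1 : ((![1, X, Z] : Fin 3 → AdeleRing (𝓞 K) K) 0).2 v = 1 := rfl
    rwa [h1, nnnorm_one] at h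
  · exact nnnorm_snd_apply_le_vecFinHeight v (![1, X, Z] : Fin 3 → AdeleRing (𝓞 K) K) 1
  · exact nnnorm_snd_apply_le_vecFinHeight v (![1, X, Z] : Fin 3 → AdeleRing (𝓞 K) K) 2

/-- `‖(1, X, Z)‖_w = √(1 + |X_w|² + |Z_w|²)` at an infinite place. [cite: Garrett2018, §2.2] -/
theorem vecArchNorm_one_three_adele (X Z : AdeleRing (𝓞 K) K) (w : InfinitePlace K) :
    vecArchNorm K w (![1, X, Z] : Fin 3 → AdeleRing (𝓞 K) K) = NNReal.sqrt (1 + ‖X.1 w‖₊ ^ 2 + ‖Z.1 w‖₊ ^ 2) := by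
  rw [vecArchNorm, Fin.sum_univ_three]
  have h0 : ((![1, X, Z] : Fin 3 → AdeleRing (𝓞 K) K) 0).1 w = 1 := rfl
  have h1 : ((![1, X, Z] : Fin 3 → AdeleRing (𝓞 K) K) 1).1 w = X.1 w := rfl
  have h2 : ((![1, X, Z] : Fin 3 → AdeleRing (𝓞 K) K) 2).1 w = Z.1 w := rfl
  rw [h0, h1, h2, nnnorm_one, one_pow]

/-- **`h(1, X, Z) = ∏_{w∣∞} √(1 + |X_w|² + |Z_w|²)^{mult w} · ∏ᶠ_v max(1, |X_v|_v, |Z_v|_v)`**. [cite: Garrett2018, §2.2] -/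
theorem vecHeight_one_three_adele_eq (X Z : AdeleRing (𝓞 K) K) :
    vecHeight K (![1, X, Z] : Fin 3 → AdeleRing (𝓞 K) K) =
      (∏ w : InfinitePlace K, NNReal.sqrt (1 + ‖X.1 w‖₊ ^ 2 + ‖Z.1 w‖₊ ^ 2) ^ w.mult) *
        ∏ᶠ v : HeightOneSpectrum (𝓞 K), max 1 (max ‖X.2 v‖₊ ‖Z.2 v‖₊) := by
  rw [vecHeight]
  congr 1
  · exact Finset.prod_congr rfl fun w _ => by rw [vecArchNorm_one_three_adele]
  · exact finprod_congr fun v => vecFinHeight_one_three_adele K X Z v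

/-- **Over a TOTALLY COMPLEX field `h(1, X, Z) = ∏_{w∣∞} (1 + |X_w|² + |Z_w|²) · ∏ᶠ_v max(1, |X_v|_v, |Z_v|_v)`**. [cite: Garrett2018, §2.2] -/
theorem vecHeight_one_three_adele_eq_of_isTotallyComplex [IsTotallyComplex K] (X Z : AdeleRing (𝓞 K) K) :
    vecHeight K (![1, X, Z] : Fin 3 → AdeleRing (𝓞 K) K) =
      (∏ w : InfinitePlace K, (1 + ‖X.1 w‖₊ ^ 2 + ‖Z.1 w‖₊ ^ 2)) * ∏ᶠ v : HeightOneSpectrum (𝓞 K), max 1 (max ‖X.2 v‖₊ ‖Z.2 v‖₊) := by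
  rw [vecHeight_one_three_adele_eq]
  congr 1
  refine Finset.prod_congr rfl fun w _ => ?_
  rw [mult_isComplex ⟨w, IsTotallyComplex.isComplex w⟩, NNReal.sq_sqrt]

/-- `1 ≤ ∏ᶠ_v max(1, |X_v|_v, |Z_v|_v)`. [cite: Garrett2018, §2.2] -/
theorem one_le_finprod_max_one_three (X Z : AdeleRing (𝓞 K) K) :
    (1 : ℝ≥0) ≤ ∏ᶠ v : HeightOneSpectrum (𝓞 K), max 1 (max ‖X.2 v‖₊ ‖Z.2 v‖₊) :=
  one_le_finprod' fun _ => le_max_left _ _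

end AffineLine

/-! ## §3 The CM archimedean structure: `c • w = w`, `ψ_w ∘ c = conj ∘ ψ_w`, `ψ_w` is real on `L⁺ ⊗ ℝ`, `φ_w(δ) ∈ iℝ`, orthogonality -/

section CMArch

variable (L : Type) [Field L] [NumberField L] [IsCMField L]

/-- `c⁻¹ = c`: complex conjugation of a CM field is an involution. [folklore] -/
theorem complexConj_symm_apply (x : L) : (IsCMField.complexConj L).symm x = IsCMField.complexConj L x := by
  rw [AlgEquiv.symm_apply_eq, IsCMField.complexConj_apply_apply]

/-- **`c • w = w`**: complex conjugation fixes every infinite place of a CM field (Mathlib `IsCMField.infinitePlace_complexConj`). [folklore] -/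
theorem complexConj_smul_infinitePlace (w : InfinitePlace L) : (IsCMField.complexConj L : L ≃ₐ[↥(maximalRealSubfield L)] L) • w = w := by
  ext x
  rw [InfinitePlace.smul_apply, complexConj_symm_apply, IsCMField.infinitePlace_complexConj]

/-- `c⁻¹ • w = w`. [folklore] -/
theorem complexConj_inv_smul_infinitePlace (w : InfinitePlace L) : (IsCMField.complexConj L : L ≃ₐ[↥(maximalRealSubfield L)] L)⁻¹ • w = w :=
  inv_smul_eq_iff.2 (complexConj_smul_infinitePlace L w).symm

omit [IsCMField L] in
/-- Transport of the archimedean component along an equality of places. [folklore] -/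
theorem extensionEmbedding_fst_congr_place {w w' : InfinitePlace L} (e : w' = w) (X : AdeleRing (𝓞 L) L) :
    Completion.extensionEmbedding w' (X.1 w') = Completion.extensionEmbedding w (X.1 w) := by
  subst e
  rfl

omit [NumberField L] [IsCMField L] in
/-- `ψ_w` on principal elements: `ψ_w(x) = φ_w(x)` for `x ∈ L` (Mathlib `extensionEmbedding_coe`). [folklore] -/
theorem extensionEmbedding_coe_field (w : InfinitePlace L) (x : L) :
    Completion.extensionEmbedding w (x : w.Completion) = w.embedding x :=
  Completion.extensionEmbedding_coe (v := w) (WithAbs.toAbs w.1 x)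

omit [NumberField L] [IsCMField L] in
/-- `ψ_w` is an isometry: `‖ψ_w(y)‖ = ‖y‖`. [folklore] -/
theorem norm_extensionEmbedding (w : InfinitePlace L) (y : w.Completion) : ‖Completion.extensionEmbedding w y‖ = ‖y‖ :=
  (Completion.isometry_extensionEmbedding w).norm_map_of_map_zero (map_zero _) y

/-- **`ψ_w ∘ c = conj ∘ ψ_w`** on the completions: for `c • w' = w` (so `w' = w`), `ψ_w (c_* y) = conj (ψ_{w'} y)` (density ★ `InfinitePlace.Completion.ext_of_coe` + Mathlib
`IsCMField.complexEmbedding_complexConj`). [cite: CasselsFrohlichANT1967, Ch. VII §1.1] -/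
theorem extensionEmbedding_galInfiniteCompletionMap_complexConj {w w' : InfinitePlace L}
    (h : (IsCMField.complexConj L : L ≃ₐ[↥(maximalRealSubfield L)] L) • w' = w) (y : w'.Completion) :
    Completion.extensionEmbedding w (galInfiniteCompletionMap (IsCMField.complexConj L : L ≃ₐ[↥(maximalRealSubfield L)] L) h y) =
      conj (Completion.extensionEmbedding w' y) := by
  have e : w' = w := by rw [← h, complexConj_smul_infinitePlace]
  subst e
  refine congrFun (InfinitePlace.Completion.ext_of_coe w'
    (f := fun y => Completion.extensionEmbedding w' (galInfiniteCompletionMap (IsCMField.complexConj L : L ≃ₐ[↥(maximalRealSubfield L)] L) h y))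
    (f' := fun y => conj (Completion.extensionEmbedding w' y))
    ((Completion.isometry_extensionEmbedding w').continuous.comp (continuous_galInfiniteCompletionMap ↥(maximalRealSubfield L) _ h))
    (Complex.continuous_conj.comp (Completion.isometry_extensionEmbedding w').continuous) fun x => ?_) y
  simp only [galInfiniteCompletionMap_coe]
  rw [extensionEmbedding_coe_field, extensionEmbedding_coe_field]
  exact IsCMField.complexEmbedding_complexConj L w'.embedding x

/-- **`ψ_w((cX)_w) = conj ψ_w(X_w)`** for every adele `X ∈ 𝔸_L` (★ `conjAdele_apply`, ★ `InfiniteAdeleRing.smul_apply`, the previous lemma at `w' = c⁻¹ • w = w`).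
[cite: CasselsFrohlichANT1967, Ch. VII §1.1] -/
theorem extensionEmbedding_fst_conjAdele (X : AdeleRing (𝓞 L) L) (w : InfinitePlace L) :
    Completion.extensionEmbedding w ((conjAdele ↥(maximalRealSubfield L) L (IsCMField.complexConj L) X).1 w) = conj (Completion.extensionEmbedding w (X.1 w)) := by
  rw [conjAdele_apply, Literature.NumberTheory.Automorphic.AdeleRing.smul_fst, InfiniteAdeleRing.smul_apply, extensionEmbedding_galInfiniteCompletionMap_complexConj,
    extensionEmbedding_fst_congr_place L (complexConj_inv_smul_infinitePlace L w)]

omit [NumberField L] [IsCMField L] in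
/-- **`ψ_w` IS REAL ON `L⁺_v ⊆ L_w`** (`v = w|_{L⁺}` real): `ψ_w (F_v ↪ L_w) = ι_v` as maps to `ℂ`, where `ι_v = extensionEmbeddingOfIsReal` (density ★ `ext_of_coe`; on `L⁺` both are
`φ_w ∘ (L⁺ ⊆ L) = φ_v`, Mathlib `comap_embedding_of_isReal`). [cite: CasselsFrohlichANT1967, Ch. II §14] -/
theorem extensionEmbedding_infiniteCompletionOfComap (w : InfinitePlace L) (hv : (w.comap (algebraMap ↥(maximalRealSubfield L) L)).IsReal)
    (y : (w.comap (algebraMap ↥(maximalRealSubfield L) L)).Completion) :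
    Completion.extensionEmbedding w (infiniteCompletionOfComap ↥(maximalRealSubfield L) L w y) = ((Completion.extensionEmbeddingOfIsReal hv y : ℝ) : ℂ) := by
  refine congrFun (InfinitePlace.Completion.ext_of_coe (w.comap (algebraMap ↥(maximalRealSubfield L) L))
    (f := fun y => Completion.extensionEmbedding w (infiniteCompletionOfComap ↥(maximalRealSubfield L) L w y))
    (f' := fun y => ((Completion.extensionEmbeddingOfIsReal hv y : ℝ) : ℂ))
    ((Completion.isometry_extensionEmbedding w).continuous.comp (continuous_infiniteCompletionOfComap ↥(maximalRealSubfield L) L w))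
    (Complex.continuous_ofReal.comp (Completion.isometry_extensionEmbeddingOfIsReal hv).continuous) fun x => ?_) y
  simp only [infiniteCompletionOfComap_coe]
  rw [extensionEmbedding_coe_field, show ((x : ↥(maximalRealSubfield L)) : (w.comap (algebraMap ↥(maximalRealSubfield L) L)).Completion) =
      ((WithAbs.toAbs (w.comap (algebraMap ↥(maximalRealSubfield L) L)).1 x : WithAbs (w.comap (algebraMap ↥(maximalRealSubfield L) L)).1) :
        (w.comap (algebraMap ↥(maximalRealSubfield L) L)).Completion) from rfl,
    Completion.extensionEmbeddingOfIsReal_coe, embedding_of_isReal_apply, comap_embedding_of_isReal _ hv]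
  rfl

omit [IsCMField L] in
/-- **`ψ_w((t ⊗ 1)_w) = (ι_{L⁺} t_∞)_{w|L⁺}`, a REAL number** (★ `AdeleRing.baseChange`, Mathlib `ringEquiv_mixedSpace_apply`). [cite: CasselsFrohlichANT1967, Ch. II §14] -/
theorem extensionEmbedding_fst_baseChange (t : AdeleRing (𝓞 ↥(maximalRealSubfield L)) ↥(maximalRealSubfield L)) (w : InfinitePlace L)
    (hv : (w.comap (algebraMap ↥(maximalRealSubfield L) L)).IsReal) :
    Completion.extensionEmbedding w ((Literature.NumberTheory.Automorphic.AdeleRing.baseChange ↥(maximalRealSubfield L) L t).1 w) =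
      (((InfiniteAdeleRing.ringEquiv_mixedSpace ↥(maximalRealSubfield L) t.1).1 ⟨w.comap (algebraMap ↥(maximalRealSubfield L) L), hv⟩ : ℝ) : ℂ) := by
  rw [Literature.NumberTheory.Automorphic.AdeleRing.baseChange_fst, Literature.NumberTheory.Automorphic.InfiniteAdeleRing.baseChange_apply,
    extensionEmbedding_infiniteCompletionOfComap L w hv, InfiniteAdeleRing.ringEquiv_mixedSpace_apply]

/-- **`conj φ_w(δ) = −φ_w(δ)`** for `δ ∈ L⁻` (`cδ = −δ`): the embedding of a trace-zero element is purely imaginary. [folklore] -/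
theorem conj_embedding_eq_neg {δ : L} (hcδ : IsCMField.complexConj L δ = -δ) (w : InfinitePlace L) : conj (w.embedding δ) = -w.embedding δ := by
  rw [← IsCMField.complexEmbedding_complexConj L w.embedding δ, hcδ, map_neg]

/-- `Re φ_w(δ) = 0` for `δ ∈ L⁻`. [folklore] -/
theorem embedding_re_eq_zero {δ : L} (hcδ : IsCMField.complexConj L δ = -δ) (w : InfinitePlace L) : (w.embedding δ).re = 0 := by
  have h := congrArg Complex.re (conj_embedding_eq_neg L hcδ w)
  rw [Complex.conj_re, Complex.neg_re] at h
  linarith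

/-- `(Im φ_w(δ))² = (w δ)²` for `δ ∈ L⁻` (Mathlib `norm_embedding_eq`). [folklore] -/
theorem embedding_im_sq {δ : L} (hcδ : IsCMField.complexConj L δ = -δ) (w : InfinitePlace L) : (w.embedding δ).im ^ 2 = (w δ) ^ 2 := by
  rw [← norm_embedding_eq w δ, Complex.sq_norm, Complex.normSq_apply, embedding_re_eq_zero L hcδ w]
  ring

/-- **`ψ_w((θ t)_w) = (ι_{L⁺} t_∞)_{w|L⁺} · φ_w(δ)`**: the trace-zero line read in `ℂ` (★ `coe_traceZeroLine`: `θ t = (t ⊗ 1)·δ`). [cite: CasselsFrohlichANT1967, Ch. II §14] -/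
theorem extensionEmbedding_fst_coe_traceZeroLine {δ : L} (hcδ : IsCMField.complexConj L δ = -δ) (hδ : δ ≠ 0)
    (t : AdeleRing (𝓞 ↥(maximalRealSubfield L)) ↥(maximalRealSubfield L)) (w : InfinitePlace L) (hv : (w.comap (algebraMap ↥(maximalRealSubfield L) L)).IsReal) :
    Completion.extensionEmbedding w (((traceZeroLine ↥(maximalRealSubfield L) L (IsCMField.complexConj L) hcδ hδ t : traceZeroAdele ↥(maximalRealSubfield L) L (IsCMField.complexConj L)) : AdeleRing (𝓞 L) L).1 w) =
      (((InfiniteAdeleRing.ringEquiv_mixedSpace ↥(maximalRealSubfield L) t.1).1 ⟨w.comap (algebraMap ↥(maximalRealSubfield L) L), hv⟩ : ℝ) : ℂ) * w.embedding δ := by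
  rw [coe_traceZeroLine]
  change Completion.extensionEmbedding w ((Literature.NumberTheory.Automorphic.AdeleRing.baseChange ↥(maximalRealSubfield L) L t).1 w * (algebraMap L (AdeleRing (𝓞 L) L) δ).1 w) = _
  rw [map_mul, extensionEmbedding_fst_baseChange L t w hv, show (algebraMap L (AdeleRing (𝓞 L) L) δ).1 w = (δ : w.Completion) from rfl, extensionEmbedding_coe_field]

/-- **`ψ_w(z(X, y)_w) = ψ_w(y_w) − ½‖X_w‖²`**: the `z`-entry `z = y − ½·X·cX` of the Heisenberg chart read in `ℂ` (`ψ_w(X_w)·conj ψ_w(X_w) = ‖X_w‖²`).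
[cite: Rogawski1990, §1.10] -/
theorem extensionEmbedding_fst_heisZ (X y : AdeleRing (𝓞 L) L) (w : InfinitePlace L) :
    Completion.extensionEmbedding w ((heisZ (c := IsCMField.complexConj L) X y).1 w) =
      Completion.extensionEmbedding w (y.1 w) - (((‖X.1 w‖ ^ 2 / 2 : ℝ)) : ℂ) := by
  rw [heisZ, halfAdele]
  change Completion.extensionEmbedding w (y.1 w - (algebraMap L (AdeleRing (𝓞 L) L) 2⁻¹).1 w * (X.1 w * (conjAdele ↥(maximalRealSubfield L) L (IsCMField.complexConj L) X).1 w)) = _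
  rw [map_sub, map_mul, map_mul, extensionEmbedding_fst_conjAdele, Complex.mul_conj, Complex.normSq_eq_norm_sq, norm_extensionEmbedding,
    show (algebraMap L (AdeleRing (𝓞 L) L) 2⁻¹).1 w = ((2⁻¹ : L) : w.Completion) from rfl, extensionEmbedding_coe_field, map_inv₀, map_ofNat]
  push_cast
  ring

/-- **ORTHOGONALITY `‖z(X, θ(ι⁻¹ s, b))_w‖² = (wδ)²·s_{w|L⁺}² + ¼‖X_w‖⁴`**: in `ℂ ≅ L_w` the centre coordinate `s·φ_w(δ)` is purely imaginary and `−½‖X_w‖²` is real.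
[cite: Rogawski1990, §1.10] [cite: CasselsFrohlichANT1967, Ch. II §14] -/
theorem norm_sq_fst_heisZ_line {δ : L} (hcδ : IsCMField.complexConj L δ = -δ) (hδ : δ ≠ 0) (X : AdeleRing (𝓞 L) L)
    (s : mixedSpace ↥(maximalRealSubfield L)) (b : FiniteAdeleRing (𝓞 ↥(maximalRealSubfield L)) ↥(maximalRealSubfield L)) (w : InfinitePlace L)
    (hv : (w.comap (algebraMap ↥(maximalRealSubfield L) L)).IsReal) :
    ‖(heisZ (c := IsCMField.complexConj L) X ((traceZeroLine ↥(maximalRealSubfield L) L (IsCMField.complexConj L) hcδ hδ (((InfiniteAdeleRing.ringEquiv_mixedSpace ↥(maximalRealSubfield L)).symm s, b) : AdeleRing (𝓞 ↥(maximalRealSubfield L)) ↥(maximalRealSubfield L)) : traceZeroAdele ↥(maximalRealSubfield L) L (IsCMField.complexConj L)) : AdeleRing (𝓞 L) L)).1 w‖ ^ 2 =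
      (w δ) ^ 2 * (s.1 ⟨w.comap (algebraMap ↥(maximalRealSubfield L) L), hv⟩) ^ 2 + (‖X.1 w‖ ^ 2 / 2) ^ 2 := by
  rw [← norm_extensionEmbedding, extensionEmbedding_fst_heisZ, extensionEmbedding_fst_coe_traceZeroLine L hcδ hδ _ w hv]
  change ‖(((InfiniteAdeleRing.ringEquiv_mixedSpace ↥(maximalRealSubfield L) ((InfiniteAdeleRing.ringEquiv_mixedSpace ↥(maximalRealSubfield L)).symm s)).1
      ⟨w.comap (algebraMap ↥(maximalRealSubfield L) L), hv⟩ : ℝ) : ℂ) * w.embedding δ - (((‖X.1 w‖ ^ 2 / 2 : ℝ)) : ℂ)‖ ^ 2 = _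
  rw [RingEquiv.apply_symm_apply, Complex.sq_norm, Complex.normSq_apply, ← embedding_im_sq L hcδ w]
  simp only [Complex.sub_re, Complex.sub_im, Complex.mul_re, Complex.mul_im, Complex.ofReal_re, Complex.ofReal_im, embedding_re_eq_zero L hcδ w]
  ring

end CMArch

/-! ## §4 The CM assembly: `H(ι(w₀)·u(X, θ(ι⁻¹ s, b))·k) = ((∏_w ((1 + ½‖X_w‖²)² + (wδ)² s_{w|L⁺}²)) · h_f(X, b))⁻¹` -/

section CM

variable (L : Type) [Field L] [NumberField L] [IsCMField L]

omit [NumberField L] [IsCMField L] in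
/-- **The finite part of `z(X, θ(a, b))` does not see `a`** (definitional). [cite: CasselsFrohlichANT1967, Ch. II §14] -/
theorem snd_heisZ_traceZeroLine_mk [NumberField L] [IsCMField L] {δ : L} (hcδ : IsCMField.complexConj L δ = -δ) (hδ : δ ≠ 0) (X : AdeleRing (𝓞 L) L)
    (a a' : InfiniteAdeleRing ↥(maximalRealSubfield L)) (b : FiniteAdeleRing (𝓞 ↥(maximalRealSubfield L)) ↥(maximalRealSubfield L)) :
    (heisZ (c := IsCMField.complexConj L) X ((traceZeroLine ↥(maximalRealSubfield L) L (IsCMField.complexConj L) hcδ hδ ((a, b) : AdeleRing (𝓞 ↥(maximalRealSubfield L)) ↥(maximalRealSubfield L)) : traceZeroAdele ↥(maximalRealSubfield L) L (IsCMField.complexConj L)) : AdeleRing (𝓞 L) L)).2 =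
      (heisZ (c := IsCMField.complexConj L) X ((traceZeroLine ↥(maximalRealSubfield L) L (IsCMField.complexConj L) hcδ hδ ((a', b) : AdeleRing (𝓞 ↥(maximalRealSubfield L)) ↥(maximalRealSubfield L)) : traceZeroAdele ↥(maximalRealSubfield L) L (IsCMField.complexConj L)) : AdeleRing (𝓞 L) L)).2 := rfl

/-- **THE HEIGHT ALONG THE BIG-CELL HEISENBERG LINE OF `U(2,1)` OVER A CM FIELD** (in `ℝ≥0`): for `k ∈ K_U`, `X ∈ 𝔸_L`, `b ∈ 𝔸_{L⁺}^∞`, `s ∈ L⁺ ⊗ ℝ`,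
`H(ι(w₀)·u(X, θ(ι⁻¹ s, b))·k) = ((∏_{w∣∞} (1 + ‖X_w‖₊² + ‖z(X, θ(ι⁻¹ s, b))_w‖₊²)) · ∏ᶠ_v max(1, ‖X_v‖₊, ‖z(X, θ(0, b))_v‖₊))⁻¹` (§1, §2, the finite part by `rfl`).
[cite: MoeglinWaldspurger1995, I.2.2, II.1.5] [cite: Garrett2018, §2.2] -/
theorem borelHeight_weylLongU_heisChart_line_mul_eq_cm_three (hc : IsCMField.complexConj L * IsCMField.complexConj L = 1) {δ : L} (hcδ : IsCMField.complexConj L δ = -δ) (hδ : δ ≠ 0)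
    {k : (quasiSplit (↥(maximalRealSubfield L)) L (IsCMField.complexConj L) 3).Adelic} (hk : k ∈ ((standardMaximalCompactGL 3 L).comap (adelicVal ↥(maximalRealSubfield L) L (IsCMField.complexConj L) 3 ((StdForm.antidiagonal 3).over L)) : Subgroup (quasiSplit (↥(maximalRealSubfield L)) L (IsCMField.complexConj L) 3).Adelic)) (X : AdeleRing (𝓞 L) L)
    (b : FiniteAdeleRing (𝓞 ↥(maximalRealSubfield L)) ↥(maximalRealSubfield L)) (s : mixedSpace ↥(maximalRealSubfield L)) :
    borelHeight (((quasiSplit (↥(maximalRealSubfield L)) L (IsCMField.complexConj L) 3).toAdelic (weylLongU ((IsCMField.complexConj L : L ≃ₐ[↥(maximalRealSubfield L)] L) : L →+* L) (rfl : ((StdForm.antidiagonal 3).over L) = ((StdForm.antidiagonal 3).over L)))) * ((heisChart hc (X, (traceZeroLine ↥(maximalRealSubfield L) L (IsCMField.complexConj L) hcδ hδ (((InfiniteAdeleRing.ringEquiv_mixedSpace ↥(maximalRealSubfield L)).symm s, b) : AdeleRing (𝓞 ↥(maximalRealSubfield L)) ↥(maximalRealSubfield L)) : traceZeroAdele ↥(maximalRealSubfield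 L) L (IsCMField.complexConj L))) : ↥(adelicUnipotent ↥(maximalRealSubfield L) L (IsCMField.complexConj L) 3)) : (quasiSplit (↥(maximalRealSubfield L)) L (IsCMField.complexConj L) 3).Adelic) * k) =
      ((∏ w : InfinitePlace L, (1 + ‖X.1 w‖₊ ^ 2 + ‖(heisZ (c := IsCMField.complexConj L) X ((traceZeroLine ↥(maximalRealSubfield L) L (IsCMField.complexConj L) hcδ hδ (((InfiniteAdeleRing.ringEquiv_mixedSpace ↥(maximalRealSubfield L)).symm s, b) : AdeleRing (𝓞 ↥(maximalRealSubfield L)) ↥(maximalRealSubfield L)) : traceZeroAdele ↥(maximalRealSubfield L) L (IsCMField.complexConj L)) : AdeleRing (𝓞 L) L)).1 w‖₊ ^ 2)) *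
        ∏ᶠ v : HeightOneSpectrum (𝓞 L), max 1 (max ‖X.2 v‖₊ ‖(heisZ (c := IsCMField.complexConj L) X ((traceZeroLine ↥(maximalRealSubfield L) L (IsCMField.complexConj L) hcδ hδ ((0, b) : AdeleRing (𝓞 ↥(maximalRealSubfield L)) ↥(maximalRealSubfield L)) : traceZeroAdele ↥(maximalRealSubfield L) L (IsCMField.complexConj L)) : AdeleRing (𝓞 L) L)).2 v‖₊))⁻¹ := by
  haveI : IsTotallyComplex L := IsCMField.isTotallyComplex L
  rw [borelHeight_weylLongU_mul_heisChart_mul hc X _ hk, vecHeight_one_three_adele_eq_of_isTotallyComplex]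
  rfl

/-- **THE SAME IN `ℝ`, PER PLACE A POSITIVE QUADRATIC IN THE CENTRE VARIABLE**: `H(ι(w₀)·u(X, θ(ι⁻¹ s, b))·k) = ((∏_{w∣∞} ((1 + ½‖X_w‖²)² + (wδ)²·s_{w|L⁺}²)) · h_f(X, b))⁻¹`,
`h_f(X, b) = ∏ᶠ_v max(1, ‖X_v‖₊, ‖z(X, θ(0,b))_v‖₊) ≥ 1` (§3 orthogonality).  Per place `A_w + c_w s²`, `A_w = (1 + ½‖X_w‖²)² ≥ 1`, `c_w = (wδ)² > 0`.
[cite: MoeglinWaldspurger1995, I.2.2, II.1.5] [cite: Garrett2018, §2.2] [cite: Rogawski1990, §1.10] -/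
theorem coe_borelHeight_weylLongU_heisChart_line_mul_eq_cm_three (hc : IsCMField.complexConj L * IsCMField.complexConj L = 1) {δ : L} (hcδ : IsCMField.complexConj L δ = -δ) (hδ : δ ≠ 0)
    {k : (quasiSplit (↥(maximalRealSubfield L)) L (IsCMField.complexConj L) 3).Adelic} (hk : k ∈ ((standardMaximalCompactGL 3 L).comap (adelicVal ↥(maximalRealSubfield L) L (IsCMField.complexConj L) 3 ((StdForm.antidiagonal 3).over L)) : Subgroup (quasiSplit (↥(maximalRealSubfield L)) L (IsCMField.complexConj L) 3).Adelic)) (X : AdeleRing (𝓞 L) L)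
    (b : FiniteAdeleRing (𝓞 ↥(maximalRealSubfield L)) ↥(maximalRealSubfield L)) (s : mixedSpace ↥(maximalRealSubfield L)) :
    (borelHeight (((quasiSplit (↥(maximalRealSubfield L)) L (IsCMField.complexConj L) 3).toAdelic (weylLongU ((IsCMField.complexConj L : L ≃ₐ[↥(maximalRealSubfield L)] L) : L →+* L) (rfl : ((StdForm.antidiagonal 3).over L) = ((StdForm.antidiagonal 3).over L)))) * ((heisChart hc (X, (traceZeroLine ↥(maximalRealSubfield L) L (IsCMField.complexConj L) hcδ hδ (((InfiniteAdeleRing.ringEquiv_mixedSpace ↥(maximalRealSubfield L)).symm s, b) : AdeleRing (𝓞 ↥(maximalRealSubfield L)) ↥(maximalRealSubfield L)) : traceZeroAdele ↥(maximalRealSubfield L) L (IsCMField.complexConj L))) : ↥(adelicUnipotent ↥(maximalRealSubfield L) L (IsCMField.complexConj L) 3)) : (quasiSplit (↥(maximalRealSubfield L)) L (IsCMField.complexConj L) 3).Adelic) * k) : ℝ) =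
      ((∏ w : InfinitePlace L, ((1 + ‖X.1 w‖ ^ 2 / 2) ^ 2 + (w δ) ^ 2 * (s.1 ⟨w.comap (algebraMap ↥(maximalRealSubfield L) L), K2E1HeightBigCellLineFormulaU2.isReal_comap_maximalRealSubfield L w⟩) ^ 2)) *
        ((∏ᶠ v : HeightOneSpectrum (𝓞 L), max 1 (max ‖X.2 v‖₊ ‖(heisZ (c := IsCMField.complexConj L) X ((traceZeroLine ↥(maximalRealSubfield L) L (IsCMField.complexConj L) hcδ hδ ((0, b) : AdeleRing (𝓞 ↥(maximalRealSubfield L)) ↥(maximalRealSubfield L)) : traceZeroAdele ↥(maximalRealSubfield L) L (IsCMField.complexConj L)) : AdeleRing (𝓞 L) L)).2 v‖₊) : ℝ≥0) : ℝ))⁻¹ := by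
  rw [borelHeight_weylLongU_heisChart_line_mul_eq_cm_three L hc hcδ hδ hk X b s, NNReal.coe_inv, NNReal.coe_mul, NNReal.coe_prod]
  congr 3
  funext w
  rw [NNReal.coe_add, NNReal.coe_add, NNReal.coe_one, NNReal.coe_pow, NNReal.coe_pow, coe_nnnorm, coe_nnnorm,
    norm_sq_fst_heisZ_line L hcδ hδ X s b w (K2E1HeightBigCellLineFormulaU2.isReal_comap_maximalRealSubfield L w)]
  ring

/-- `1 ≤ h_f(X, b)`: the finite factor is at least one. [cite: Garrett2018, §2.2] -/
theorem one_le_coe_finprod_heisZ_line_cm_three {δ : L} (hcδ : IsCMField.complexConj L δ = -δ) (hδ : δ ≠ 0) (X : AdeleRing (𝓞 L) L)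
    (b : FiniteAdeleRing (𝓞 ↥(maximalRealSubfield L)) ↥(maximalRealSubfield L)) :
    (1 : ℝ) ≤ ((∏ᶠ v : HeightOneSpectrum (𝓞 L), max 1 (max ‖X.2 v‖₊ ‖(heisZ (c := IsCMField.complexConj L) X ((traceZeroLine ↥(maximalRealSubfield L) L (IsCMField.complexConj L) hcδ hδ ((0, b) : AdeleRing (𝓞 ↥(maximalRealSubfield L)) ↥(maximalRealSubfield L)) : traceZeroAdele ↥(maximalRealSubfield L) L (IsCMField.complexConj L)) : AdeleRing (𝓞 L) L)).2 v‖₊) : ℝ≥0) : ℝ) := by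
  exact_mod_cast one_le_finprod_max_one_three L X _

omit [IsCMField L] in
/-- `1 ≤ (1 + ½‖X_w‖²)²`: the constant term `A_w` of the place quadratic is at least one. [folklore] -/
theorem one_le_sq_one_add_half_norm_sq (X : AdeleRing (𝓞 L) L) (w : InfinitePlace L) : (1 : ℝ) ≤ (1 + ‖X.1 w‖ ^ 2 / 2) ^ 2 := by
  have h : (0 : ℝ) ≤ ‖X.1 w‖ ^ 2 / 2 := by positivity
  nlinarith

end CM

end Summit.HodgeConjecture.HodgeConjecture.Cruxes.H413.K2E1HeightBigCellLineFormulaU3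

end
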